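import Literature.AlgebraicGeometry.Frobenioids.UnitWiseFrobeniusZetaExists
import HarnessLib

/-!
# Frobenioids I, Proposition 2.9 (ii): the unit-wise Frobenius functor in STRICT normal form
# (`Ψ(A) = A`, `Ψ` lies over `F_Φ` on the nose, `Ψ(u) = u^ζ` on `O^×(A)` with no conjugating isomorphism)

Mochizuki, *The geometry of Frobenioids I: the general theory*, Kyushu J. Math. **62** (2008)
293–400, §2, Proposition 2.9 (ii) and its proof, kurims text pp. 53–55
[cite: MochizukiFrdI2008, Prop. 2.9(ii) p.53], verbatim (kurims p. 53 ll. 10–26; clause (b) elided,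
marked «[…]»): "Then there exists a functor `Ψ : C → C` — which we shall refer to as the *unit-wise
Frobenius functor* [associated to `τ`, `ζ`] — which satisfies the following properties: (a) `Ψ` is
1-compatible, relative to the functor `C → F_Φ`, with the identity functor on `F_Φ`. […] (c) If
`A ∈ Ob(C)`, then there exists an isomorphism `Ψ(A) ≅ A` such that the endomorphism of `O^×(A)` induced
by `Ψ` followed by conjugation by this isomorphism is given by raising to the `ζ`-th power. (d) If `ζ`
is of co-prime type [cf. Definition 2.8, (iii)], then `Ψ` is an equivalence of categories. If `C` is
of unit-trivial type, then `Ψ` is isomorphic to the identity functor."  The paper works on a skeleton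
(proof, p. 53 ll. 27–29: "we may assume, without loss of generality, … that the category `C` is a
skeleton"), where `Ψ(A) = A` and, verbatim p. 54 ll. 43–45, "`Ψ(φ) := α ∘ Ψ(β) ∘ γ`"; the tree's
`UnitWiseFrobeniusZeta.psi` (abc-iut-L6-t9 lineage) instead retracts onto a base-section `P`, so
`psi.obj A = A_P` with a chosen `repIso A : A ≅ A_P`.

This file (abc-iut cell, layer L1, seat abc-iut-w5-d248 gen 3; input for the FUNCTOR-LEVEL form of
[FrdII] Rmk. 2.4.2, sub-piece (α-ζ) of GAP row G-L1t7-α named by abc-iut-L1-t7) CONJUGATES `psi` by the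
isomorphisms `repIso` — a functor naturally isomorphic to `psi` (`psiStrictIso`), hence a unit-wise
Frobenius functor in the sense of the proposition — and records the resulting STRICT forms of (a)–(d),
all derived from the landed proofs (`map_psiHom`, `psiHom_unit`, `psiHom_id`, `psiHom_comp`,
`psi_isEquivalence`, `isZetaPowerMap_zetaPow`):
* `psiStrict.obj A = A` definitionally (the definition is reducible, so this holds by `rfl` in types);
* (a) strict: `F (psiStrict φ) = F φ` on the nose (`map_psiStrict`), i.e. the square `0`-commutes
  (`psiStrict_zeroCommutes`), and `Base`, `Div`, `deg_Fr`, `O^▷(−)`, `O^×(−)` are preserved literally;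
* (c) strict: `psiStrict u = u^ζ` for `u ∈ O^×(A)` (`psiStrict_map_unit`), in particular a unit of
  `l`-power order goes to its `ζ(l)`-th power (`psiStrict_map_unit_of_pow_eq_one`);
* (d): `psiStrict` is an equivalence for `ζ` of co-prime type (`psiStrict_isEquivalence`), and `≅ 𝟭`
  for `C` of unit-trivial type (`psiStrict_iso_id`).
No statement of the paper is strengthened beyond this normal form; nothing here concerns [IUTchIII].
-/

noncomputable section

namespace Literature.AlgebraicGeometry.Frobenioids

open CategoryTheory Opposite

universe w v v' u u'

/-- An element killed by a power of the prime `l` lies in the pro-`l` portion `M[l]` (Def. 2.8 (ii)),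
for any topology. [cite: MochizukiFrdI2008, Def. 2.8(ii) p.52] -/
theorem mem_proL_of_pow_eq_one {M : Type u} [CommGroup M] [TopologicalSpace M] (l : Nat.Primes)
    {x : M} {k : ℕ} (hx : x ^ ((l : ℕ) ^ k) = 1) : x ∈ proL M l :=
  mem_proL_iff.mpr fun U => ⟨k, by rw [hx]; exact U.one_mem⟩

namespace PreFrobenioid

namespace UnitWiseFrobeniusZeta

variable {D : Type u} [Category.{v} D] {Φ : Dᵒᵖ ⥤ CommMonCat.{w}}
  {C : Type u'} [Category.{v'} C] {F : C ⥤ ElemFrobenioid Φ}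
  (hF : IsFrobenioid F) (τ : CharacteristicSplitting F) (hnorm : IsOfType (IsFrobeniusNormalized F))
  (hbt : IsOfType (IsBaseTrivial F)) (histr : IsOfIsotropicType F) (hup : IsOfUnitProfiniteType F)
  {P : Presection C} {Fr : ℕ+ →* End P.ι} (hpair : IsBaseFrobeniusPair F P Fr) (ζ : Nat.Primes → ℕ+)

/-! ### The functor -/

include hnorm in
/-- **The unit-wise Frobenius functor in strict normal form**: `Ψ(A) := A`,
`Ψ(φ) := i_A ; Ψ_P(i_A⁻¹ ; φ ; i_B) ; i_B⁻¹` for the chosen isomorphisms `i_A = repIso A : A ≅ A_P` — i.e.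
`UnitWiseFrobeniusZeta.psi` conjugated by the `i_A` (the paper's skeletal convention, proof p. 53
ll. 27–29: `C` is replaced by a skeleton, on which `Ψ` is the identity on objects — a paraphrase, not
a quotation). Reducible, so that `Ψ.obj A` is `A` in types. [cite: MochizukiFrdI2008, Prop. 2.9(ii) p.54] -/
@[reducible] def psiStrict : C ⥤ C where
  obj A := A
  map {A B} φ := (repIso hbt hpair A).hom ≫
    psiHom hF τ histr hup hpair ζ (repP_mem hpair A) (repP_mem hpair B)
      ((repIso hbt hpair A).inv ≫ φ ≫ (repIso hbt hpair B).hom) ≫ (repIso hbt hpair B).inv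
  map_id A := by
    rw [Category.id_comp, Iso.inv_hom_id, psiHom_id hF τ histr hup hpair ζ, Category.id_comp, Iso.hom_inv_id]
  map_comp {A B E} φ ψ := by
    have h : (repIso hbt hpair A).inv ≫ (φ ≫ ψ) ≫ (repIso hbt hpair E).hom =
        ((repIso hbt hpair A).inv ≫ φ ≫ (repIso hbt hpair B).hom) ≫
          ((repIso hbt hpair B).inv ≫ ψ ≫ (repIso hbt hpair E).hom) := by
      simp only [Category.assoc, Iso.hom_inv_id_assoc]
    rw [h, psiHom_comp hF τ hnorm histr hup hpair ζ (repP_mem hpair A) (repP_mem hpair B) (repP_mem hpair E)]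
    simp only [Category.assoc, Iso.inv_hom_id_assoc]

/-- `Ψ(A) = A`. [cite: MochizukiFrdI2008, Prop. 2.9(ii) p.54] -/
@[simp] theorem psiStrict_obj (A : C) : (psiStrict hF τ hnorm hbt histr hup hpair ζ).obj A = A := rfl

/-- `Ψ` on arrows: `i_A ; Ψ_P(i_A⁻¹ ; φ ; i_B) ; i_B⁻¹`. [cite: MochizukiFrdI2008, Prop. 2.9(ii) p.54] -/
theorem psiStrict_map {A B : C} (φ : A ⟶ B) :
    (psiStrict hF τ hnorm hbt histr hup hpair ζ).map φ =
      (repIso hbt hpair A).hom ≫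
        psiHom hF τ histr hup hpair ζ (repP_mem hpair A) (repP_mem hpair B)
          ((repIso hbt hpair A).inv ≫ φ ≫ (repIso hbt hpair B).hom) ≫ (repIso hbt hpair B).inv := rfl

/-- `Ψ` on arrows through `psi`: `Ψ(φ) = i_A ; psi(φ) ; i_B⁻¹`. [cite: MochizukiFrdI2008, Prop. 2.9(ii) p.54] -/
theorem psiStrict_map_eq_conj {A B : C} (φ : A ⟶ B) :
    (psiStrict hF τ hnorm hbt histr hup hpair ζ).map φ =
      (repIso hbt hpair A).hom ≫ (psi hF τ hnorm hbt histr hup hpair ζ).map φ ≫ (repIso hbt hpair B).inv := rfl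

/-- **The strict form is naturally isomorphic to `psi`** (components `repIso A : A ≅ A_P`), so it is a
unit-wise Frobenius functor in the sense of Prop. 2.9 (ii). [cite: MochizukiFrdI2008, Prop. 2.9(ii) p.53] -/
def psiStrictIso : psiStrict hF τ hnorm hbt histr hup hpair ζ ≅ psi hF τ hnorm hbt histr hup hpair ζ :=
  NatIso.ofComponents (fun A => repIso hbt hpair A) (fun {A B} φ => by
    show ((repIso hbt hpair A).hom ≫ (psi hF τ hnorm hbt histr hup hpair ζ).map φ ≫ (repIso hbt hpair B).inv) ≫
        (repIso hbt hpair B).hom = (repIso hbt hpair A).hom ≫ (psi hF τ hnorm hbt histr hup hpair ζ).map φ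
    simp only [Category.assoc]
    erw [(repIso hbt hpair B).inv_hom_id]
    erw [Category.comp_id]
    rfl)

/-! ### (a), strict: `Ψ` lies over `F_Φ` on the nose -/

/-- **Prop. 2.9 (ii)(a), strict form**: `F(Ψ φ) = F(φ)` — `Ψ` commutes with `C → F_Φ` ON THE NOSE
(from `map_psiHom`). [cite: MochizukiFrdI2008, Prop. 2.9(ii) p.55] -/
theorem map_psiStrict {A B : C} (φ : A ⟶ B) :
    F.map ((psiStrict hF τ hnorm hbt histr hup hpair ζ).map φ) = F.map φ := by
  rw [psiStrict_map, F.map_comp, F.map_comp, map_psiHom hF τ histr hup hpair ζ, ← F.map_comp, ← F.map_comp]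
  simp only [Category.assoc, Iso.hom_inv_id, Category.comp_id, Iso.hom_inv_id_assoc]

/-- `Ψ ⋙ (C → F_Φ) = (C → F_Φ)`: the square of (a) `0`-commutes ("commutes in the literal sense",
[FrdI] §0). [cite: MochizukiFrdI2008, Prop. 2.9(ii) p.55] -/
theorem psiStrict_comp : psiStrict hF τ hnorm hbt histr hup hpair ζ ⋙ F = F :=
  Functor.hext (fun _ => rfl) (fun _ _ φ => heq_of_eq (map_psiStrict hF τ hnorm hbt histr hup hpair ζ φ))

/-- (a) strict, in the vocabulary of [FrdI] §0: `Ψ` `0`-commutes with the identity of `F_Φ` relative to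
`C → F_Φ`. [cite: MochizukiFrdI2008, Prop. 2.9(ii) p.53] -/
theorem psiStrict_zeroCommutes :
    ZeroCommutes (psiStrict hF τ hnorm hbt histr hup hpair ζ) F F (𝟭 (ElemFrobenioid Φ)) := by
  show psiStrict hF τ hnorm hbt histr hup hpair ζ ⋙ F = F ⋙ 𝟭 (ElemFrobenioid Φ)
  rw [psiStrict_comp, Functor.comp_id]

/-- Prop. 2.9 (ii)(a) for the strict form: `1`-compatibility with the identity of `F_Φ`.
[cite: MochizukiFrdI2008, Prop. 2.9(ii) p.53] -/
theorem psiStrict_oneCommutes :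
    OneCommutes (psiStrict hF τ hnorm hbt histr hup hpair ζ) F F (𝟭 (ElemFrobenioid Φ)) :=
  ⟨eqToIso (psiStrict_zeroCommutes hF τ hnorm hbt histr hup hpair ζ)⟩

/-- `Base(Ψ φ) = Base(φ)`. [cite: MochizukiFrdI2008, Prop. 2.9(ii) p.55] -/
theorem base_psiStrict {A B : C} (φ : A ⟶ B) :
    Base F ((psiStrict hF τ hnorm hbt histr hup hpair ζ).map φ) = Base F φ := by
  unfold Base
  rw [map_psiStrict]

/-- `Div(Ψ φ) = Div(φ)`. [cite: MochizukiFrdI2008, Prop. 2.9(ii) p.55] -/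
theorem div_psiStrict {A B : C} (φ : A ⟶ B) :
    Div F ((psiStrict hF τ hnorm hbt histr hup hpair ζ).map φ) = Div F φ := by
  unfold Div
  rw [map_psiStrict]

/-- `deg_Fr(Ψ φ) = deg_Fr(φ)`. [cite: MochizukiFrdI2008, Prop. 2.9(ii) p.55] -/
theorem degFr_psiStrict {A B : C} (φ : A ⟶ B) :
    degFr F ((psiStrict hF τ hnorm hbt histr hup hpair ζ).map φ) = degFr F φ := by
  unfold degFr
  rw [map_psiStrict]

/-- `Ψ` preserves `O^▷(A)` literally: `φ ∈ O^▷(A) ↔ Ψ φ ∈ O^▷(A)` ("`Ψ` preserves `O^⊳(−)`", the input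
`hO` of [FrdII] Thm. 2.4 (i)'s context isomorphism). [cite: MochizukiFrdI2008, Prop. 2.9(ii) p.55] -/
theorem mem_endSubmonoid_psiStrict_iff {A : C} (φ : A ⟶ A) :
    φ ∈ endSubmonoid F A ↔ (psiStrict hF τ hnorm hbt histr hup hpair ζ).map φ ∈ endSubmonoid F A := by
  change IsBaseIdentity F φ ∧ IsLinear F φ ↔
    IsBaseIdentity F ((psiStrict hF τ hnorm hbt histr hup hpair ζ).map φ) ∧
      IsLinear F ((psiStrict hF τ hnorm hbt histr hup hpair ζ).map φ)
  unfold IsBaseIdentity IsLinear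
  rw [base_psiStrict, degFr_psiStrict]

/-- `Ψ` preserves `O^×(A)` literally. [cite: MochizukiFrdI2008, Prop. 2.9(ii) p.55] -/
theorem mapIso_psiStrict_mem_unitsSubgroup_iff {A : C} (α : Aut A) :
    (psiStrict hF τ hnorm hbt histr hup hpair ζ).mapIso α ∈ unitsSubgroup F A ↔ α ∈ unitsSubgroup F A := by
  change IsBaseIdentity F ((psiStrict hF τ hnorm hbt histr hup hpair ζ).map α.hom) ∧
      IsLinear F ((psiStrict hF τ hnorm hbt histr hup hpair ζ).map α.hom) ↔
    IsBaseIdentity F α.hom ∧ IsLinear F α.hom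
  unfold IsBaseIdentity IsLinear
  rw [base_psiStrict, degFr_psiStrict]

/-! ### (c), strict: `Ψ(u) = u^ζ` on `O^×(A)` -/

/-- **Prop. 2.9 (ii)(c), strict form**: on `O^×(A)` the functor `Ψ` IS the `ζ`-th power map `zetaPow`
(for the chosen profinite topology of `O^×(A)`), with no conjugating isomorphism.
[cite: MochizukiFrdI2008, Prop. 2.9(ii) p.53] -/
theorem psiStrict_map_unit {A : C} (u : unitsSubgroup F A) :
    (psiStrict hF τ hnorm hbt histr hup hpair ζ).map u.1.hom = (zetaPow hF hup ζ A u).1.hom := by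
  let i := repIso hbt hpair A
  rw [psiStrict_map]
  show i.hom ≫ psiHom hF τ histr hup hpair ζ _ _ (i.inv ≫ u.1.hom ≫ i.hom) ≫ i.inv = _
  rw [← conjUnits_hom, psiHom_unit hF τ histr hup hpair ζ (repP_mem hpair A)]
  have h := conjUnits_hom (F := F) i.symm (zetaPow hF hup ζ _ (conjUnits (F := F) i u))
  rw [Iso.symm_inv, Iso.symm_hom] at h
  rw [← h, map_zetaPow hF hup ζ (conjUnits (F := F) i.symm), conjUnits_symm_conjUnits]

/-- `Ψ` on `O^×(A)` as an automorphism: `Ψ(u) = u^ζ` in `O^×(A) ⊆ Aut_C(A)`.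
[cite: MochizukiFrdI2008, Prop. 2.9(ii) p.53] -/
theorem mapIso_psiStrict_unit {A : C} (u : unitsSubgroup F A) :
    (psiStrict hF τ hnorm hbt histr hup hpair ζ).mapIso u.1 = (zetaPow hF hup ζ A u).1 :=
  Iso.ext (psiStrict_map_unit hF τ hnorm hbt histr hup hpair ζ u)

/-- A unit of `l`-power order is sent by the `ζ`-th power map to its `ζ(l)`-th power (it lies in the
pro-`l` portion `O^×(A)[l]`, Def. 2.8 (ii)(iii)). [cite: MochizukiFrdI2008, Def. 2.8(iii) p.52] -/
theorem zetaPow_of_pow_eq_one {A : C} (l : Nat.Primes) {k : ℕ} (u : unitsSubgroup F A)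
    (hu : u ^ ((l : ℕ) ^ k) = 1) : zetaPow hF hup ζ A u = u ^ ((ζ l : ℕ+) : ℕ) :=
  letI : CommGroup (unitsSubgroup F A) := unitsCommGroup F hF A
  letI : TopologicalSpace (unitsSubgroup F A) := unitsTopology hup A
  (isZetaPowerMap_zetaPow hF hup ζ A).eq_pow l u (mem_proL_of_pow_eq_one l hu)

/-- **Prop. 2.9 (ii)(c) on torsion**: a unit `u ∈ O^×(A)` of `l`-power order satisfies `Ψ(u) = u^{ζ(l)}`.
[cite: MochizukiFrdI2008, Prop. 2.9(ii) p.53] -/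
theorem psiStrict_map_unit_of_pow_eq_one {A : C} (l : Nat.Primes) {k : ℕ} (u : unitsSubgroup F A)
    (hu : u ^ ((l : ℕ) ^ k) = 1) :
    (psiStrict hF τ hnorm hbt histr hup hpair ζ).map u.1.hom =
      ((u ^ ((ζ l : ℕ+) : ℕ) : unitsSubgroup F A) : Aut A).hom := by
  rw [psiStrict_map_unit, zetaPow_of_pow_eq_one hF hup ζ l u hu]

/-- The same for the automorphism: `Ψ(u) = u^{ζ(l)}` in `Aut_C(A)`. [cite: MochizukiFrdI2008, Prop. 2.9(ii) p.53] -/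
theorem mapIso_psiStrict_unit_of_pow_eq_one {A : C} (l : Nat.Primes) {k : ℕ} (u : unitsSubgroup F A)
    (hu : u ^ ((l : ℕ) ^ k) = 1) :
    (psiStrict hF τ hnorm hbt histr hup hpair ζ).mapIso u.1 = ((u ^ ((ζ l : ℕ+) : ℕ) : unitsSubgroup F A) : Aut A) :=
  Iso.ext (psiStrict_map_unit_of_pow_eq_one hF τ hnorm hbt histr hup hpair ζ l u hu)

/-! ### (d): equivalence -/

/-- **Prop. 2.9 (ii)(d)** for the strict form: `ζ` of co-prime type ⇒ `Ψ` is an equivalence.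
[cite: MochizukiFrdI2008, Prop. 2.9(ii) p.53] -/
theorem psiStrict_isEquivalence (hζ : IsOfCoprimeType ζ) :
    (psiStrict hF τ hnorm hbt histr hup hpair ζ).IsEquivalence :=
  haveI := psi_isEquivalence hF τ hnorm hbt histr hup hpair ζ hζ
  Functor.isEquivalence_of_iso (psiStrictIso hF τ hnorm hbt histr hup hpair ζ).symm

/-- (d), second clause, strict form: for `C` of unit-trivial type `Ψ ≅ 𝟭`. [cite: MochizukiFrdI2008, Prop. 2.9(ii) p.53] -/
theorem psiStrict_iso_id (hut : IsOfType (IsUnitTrivial F)) :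
    Nonempty (psiStrict hF τ hnorm hbt histr hup hpair ζ ≅ 𝟭 C) := by
  obtain ⟨e⟩ := psi_iso_id hF τ hnorm hbt histr hup hpair ζ hut
  exact ⟨psiStrictIso hF τ hnorm hbt histr hup hpair ζ ≪≫ e⟩

end UnitWiseFrobeniusZeta

end PreFrobenioid

end Literature.AlgebraicGeometry.Frobenioids

end
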